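import Mathlib.Analysis.InnerProductSpace.GramSchmidtOrtho
import Mathlib.Analysis.InnerProductSpace.PiL2
import Mathlib.Analysis.InnerProductSpace.Calculus
import Mathlib.Analysis.InnerProductSpace.Projection.Reflection
import Mathlib.Analysis.InnerProductSpace.Projection.FiniteDimensional
import Mathlib.Geometry.Manifold.ContMDiff.NormedSpace
import Mathlib.Geometry.Manifold.ContMDiff.Atlas
import Mathlib.Geometry.Manifold.ContMDiffMFDeriv
import Mathlib.Geometry.Manifold.SmoothApprox
import Mathlib.Topology.MetricSpace.HausdorffDimension
import Literature.Topology.FourManifolds.SphereMapsMissPoints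
import Literature.Topology.FourManifolds.WhitneySphereEmbedding
import HarnessLib

/-!
# Kervaire–Milnor's Lemma 3.3: an s-parallelizable submanifold of a sphere has a normal framing

Topic `Literature/Topology/FourManifolds`; proof file attached to `WhitneySphereEmbedding.lean`.
It **discharges**, sorry-free, the named fact
`Literature.Topology.FourManifolds.exists_isNormalFraming_of_isStablyParallelizable`
(Kervaire–Milnor, *Groups of homotopy spheres I*, Ann. of Math. 77 (1963), §3, Lemma 3.3,
direction `⇒`, p. 509: "Let `M` be an `n`-dimensional submanifold of `Sⁿ⁺ᵏ`, `n < k`. Then `M` is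
s-parallelizable if and only if its normal bundle is trivial"), in the tree's language: for a
compact `C^∞` manifold `M` modelled on `ℝⁿ` with a continuous framing of `TM ⊕ ℝ`
(`IsStablyParallelizable`, `Spin.lean`) and a `C^∞` immersion `f : M → 𝕊ⁿ⁺ᵏ`, `n < k`, there are
`k` smooth fields along `f`, tangent to the sphere and independent modulo `df(TM)`
(`IsNormalFraming`, `FramedTubularNbhd.lean`):
`Literature.Topology.FourManifolds.exists_isNormalFraming_of_isStablyParallelizable_holds`, from
the version for immersions into the unit sphere of any inner product space `E` of dimension
`n + k + 1`,
`Literature.Topology.FourManifolds.exists_isNormalFraming_of_isStablyParallelizable_of_lt`.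

## The printed proof and its formalisation

Kervaire–Milnor (p. 509) deduce Lemma 3.3 from "LEMMA 3.5. *Let `ξ` be a `k`-dimensional vector
space bundle over an `n`-dimensional complex, `k > n`. If the Whitney sum of `ξ` with a trivial
bundle `εʳ` is trivial then `ξ` itself is trivial.* PROOF. We may assume that `r = 1` … An
isomorphism `ξ ⊕ ε¹ ≈ εᵏ⁺¹` gives rise to a bundle map `f` from `ξ` to the bundle `γᵏ` of oriented
`k`-planes in `(k + 1)`-space. Since the base space of `ξ` has dimension `n`, and since the base
space of `γᵏ` is the sphere `Sᵏ`, `k > n`, it follows that `f` is null-homotopic; and hence that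
`ξ` is trivial", and then: "Let `τ`, `ν` denote the tangent and normal bundles of `M`. Then `τ ⊕ ν`
is trivial hence `(τ ⊕ ε¹) ⊕ ν` is trivial. Applying Lemma 3.5 the conclusion follows."

The tree has no vector bundles beyond Mathlib's tangent bundle, no classifying maps and no
homotopy theory, so both lemmas are proved here **in terms of frames in a fixed Euclidean space**:

* `(τ ⊕ ε¹) ⊕ ν = εⁿ⁺ᵏ⁺¹`: the framing `(vⱼ, tⱼ)ⱼ` of `TM ⊕ ℝ` is carried by the injective linear
  maps `Lₓ (v, t) = d(ι ∘ f)ₓ v + t f(x)` to `n + 1` continuous, pointwise independent fields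
  `Uⱼ : M → ℝⁿ⁺ᵏ⁺¹` spanning `df(TₓM) ⊕ ℝ f(x)`, whose orthogonal complement in `ℝⁿ⁺ᵏ⁺¹` is the
  normal space (`continuous_ambientDeriv_apply`: continuity of `T(ι ∘ f)` on continuous sections);
  Gram–Schmidt, continuous in the point (`continuous_gramSchmidtNormed_family`), makes them
  orthonormal.
* **Lemma 3.5 in frame form** (`exists_orthonormal_sumElim`): continuous pointwise orthonormal
  `u₁, …, u_m : M → F`, `dim F = m + p`, `p > n = dim M`, are completed by continuous
  `w₁, …, w_p` to an orthonormal frame at every point. Induction on the rank `m` of the trivial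
  summand (the printed "we may assume `r = 1`"); the step expresses `u_{m+1}` in a completing
  frame of `(u₁, …, u_m)` as a unit coefficient field `c : M → 𝕊ᵖ ⊂ ℝᵖ⁺¹` — the printed bundle
  map to `γᵖ` over `Sᵖ` — and completes `c` (`exists_orthonormal_cons`). Where the printed proof
  invokes "`k > n`, it follows that `f` is null-homotopic", we use the easy case of Sard's theorem
  in the form already in the tree (`SphereMapsMissPoints.lean`, Hirsch Ch. 3 §1 Prop. 1.2, via
  Hausdorff dimension; here `dimH_range_le_of_contMDiff` for a general compact `n`-manifold):
  a smooth approximation `c̃` of `c` misses a point `e ∈ 𝕊ᵖ`, and over `𝕊ᵖ ∖ {e}` the bundle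
  `γᵖ` is trivialised explicitly by the reflections in the lines `ℝ(y - e)` (Mathlib's
  `Submodule.reflection`; `reflection_span_add_apply_left`: the reflection in `ℝ(a + b)` swaps
  the unit vectors `a`, `b`), which carry a fixed orthonormal basis `(-e, b₁, …, b_p)` to
  `(c̃ x, …)`; one more reflection, in `ℝ(c̃ x + c x)`, moves `c̃ x` to `c x`.
* The completing fields are smoothed by Mathlib's `Continuous.exists_contMDiff_approx`
  (independence of a frame is an open condition:
  `linearIndependent_of_orthonormal_of_sum_norm_sub_lt`) and projected to `T_{f x} 𝕊ⁿ⁺ᵏ`;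
  independence modulo `df(TₓM)` follows because `df(TₓM)` and `f(x)` lie in the span of the `Uⱼ`.

Everything in this file is proved; no definitions, notations, instances or named facts are
introduced (the `Fact (finrank ℝ E = m + 1)` assumptions of Mathlib's sphere API are instance
arguments, supplied by `finrank_euclideanSpace_fin` in the discharge). The hypothesis
`Injective f` of the named fact is not needed (the statement holds for immersions).

## References

* M. Kervaire, J. Milnor, *Groups of homotopy spheres I*, Ann. of Math. 77 (1963), §3,
  Lemma 3.3 and Lemma 3.5 with their proofs (p. 509). [KervaireMilnorAnnals1963]
* M. W. Hirsch, *Differential Topology*, GTM 33 (1976), Ch. 3 §1 Prop. 1.2 (`f(M)` is nowhere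
  dense if `dim M < dim N`), Ch. 4 §2 (stably trivial bundles). [HirschDT1976]
-/

open scoped Manifold ContDiff Topology InnerProductSpace ENNReal
open Set Function Module InnerProductSpace Metric Bundle Submodule

noncomputable section

namespace Literature.Topology.FourManifolds

section Reflection

variable {F : Type*} [NormedAddCommGroup F] [InnerProductSpace ℝ F]

/-- **Reflection through a line, in coordinates**: Mathlib's reflection `(ℝ ∙ u).reflection` in the
line `ℝ u` is `v ↦ (2⟪u, v⟫ / ‖u‖²) u - v` (for `u = 0` both sides are `-v`). [folklore] -/
theorem reflection_span_singleton_apply (u v : F) :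
    (ℝ ∙ u).reflection v = (2 * ⟪u, v⟫_ℝ / ‖u‖ ^ 2) • u - v := by
  rw [Submodule.reflection_apply, starProjection_singleton, two_smul, ← add_smul]
  simp only [RCLike.ofReal_real_eq_id, id_eq]
  congr 1
  ring

/-- **The reflection in the line `ℝ (a + b)` swaps the unit vectors `a` and `b`** (it is minus the
reflection in the bisecting hyperplane `(a + b)ᗮ`, which maps `a` to `-b`:
`Submodule.reflection_sub`). [folklore] -/
theorem reflection_span_add_apply_left {a b : F} (ha : ‖a‖ = 1) (hb : ‖b‖ = 1) :
    (ℝ ∙ (a + b)).reflection a = b := by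
  have h1 : (ℝ ∙ (a + b))ᗮ.reflection a = -b := by
    rw [← sub_neg_eq_add]
    exact Submodule.reflection_sub (by rw [ha, norm_neg, hb])
  have h2 := Submodule.reflection_orthogonal_apply (ℝ ∙ (a + b)) a
  exact neg_inj.1 (h2.symm.trans h1)

/-- The line reflection `(u, v) ↦ (ℝ ∙ u).reflection v` is smooth in both arguments off
`u = 0`. [folklore] -/
theorem contDiffAt_reflection_span_singleton {q : F × F} (hq : q.1 ≠ 0) :
    ContDiffAt ℝ ∞ (fun q : F × F => (ℝ ∙ q.1).reflection q.2) q := by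
  simp_rw [reflection_span_singleton_apply]
  have h1 : ContDiffAt ℝ ∞ (fun q : F × F => ⟪q.1, q.2⟫_ℝ) q :=
    contDiffAt_fst.inner ℝ contDiffAt_snd
  have h2 : ContDiffAt ℝ ∞ (fun q : F × F => ‖q.1‖ ^ 2) q := by
    have : ContDiffAt ℝ ∞ (fun q : F × F => ⟪q.1, q.1⟫_ℝ) q := contDiffAt_fst.inner ℝ contDiffAt_fst
    simpa only [real_inner_self_eq_norm_sq] using this
  refine ContDiffAt.sub (ContDiffAt.smul ?_ contDiffAt_fst) contDiffAt_snd
  exact (contDiffAt_const.mul h1).div h2 (pow_ne_zero _ (norm_ne_zero_iff.2 hq))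

/-- Continuity of `x ↦ (ℝ ∙ u x).reflection (v x)` for continuous `u`, `v` with `u x ≠ 0`.
[folklore] -/
theorem continuous_reflection_span_singleton {X : Type*} [TopologicalSpace X] {u v : X → F}
    (hu : Continuous u) (hv : Continuous v) (h0 : ∀ x, u x ≠ 0) :
    Continuous fun x => (ℝ ∙ u x).reflection (v x) :=
  continuous_iff_continuousAt.2 fun x =>
    ContinuousAt.comp (f := fun x => (u x, v x))
      (contDiffAt_reflection_span_singleton (q := (u x, v x)) (h0 x)).continuousAt
      (hu.continuousAt.prodMk hv.continuousAt)

variable {EM HM : Type*} [NormedAddCommGroup EM] [NormedSpace ℝ EM] [TopologicalSpace HM]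
  {I : ModelWithCorners ℝ EM HM} {M : Type*} [TopologicalSpace M] [ChartedSpace HM M]

/-- Smoothness of `x ↦ (ℝ ∙ u x).reflection (v x)` for `C^∞` maps `u`, `v` into `F` with
`u x ≠ 0`. [folklore] -/
theorem contMDiff_reflection_span_singleton {u v : M → F}
    (hu : ContMDiff I 𝓘(ℝ, F) ∞ u) (hv : ContMDiff I 𝓘(ℝ, F) ∞ v) (h0 : ∀ x, u x ≠ 0) :
    ContMDiff I 𝓘(ℝ, F) ∞ fun x => (ℝ ∙ u x).reflection (v x) := fun x =>
  ContDiffAt.comp_contMDiffAt (I := I) (g := fun q : F × F => (ℝ ∙ q.1).reflection q.2)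
    (f := fun x => (u x, v x)) (x := x) (contDiffAt_reflection_span_singleton (h0 x))
    (hu.prodMk_space hv x)

end Reflection

section GramSchmidt

variable {F : Type*} [NormedAddCommGroup F] [InnerProductSpace ℝ F]
  {ι : Type*} [LinearOrder ι] [LocallyFiniteOrderBot ι] [WellFoundedLT ι]
  {X : Type*} [TopologicalSpace X]

/-- **Gram–Schmidt is continuous in the family**: if `u i : X → F` are continuous and pointwise
linearly independent, each Gram–Schmidt vector `x ↦ gramSchmidt ℝ (u · x) i` is continuous
(well-founded induction along `gramSchmidt_def''`; the denominators `‖gs j‖²` do not vanish by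
linear independence). The fixed-space analogue of the tree's
`Literature.Geometry.Kaehler.contMDiffOn_gramSchmidt_section`. [folklore] -/
theorem continuous_gramSchmidt_family {u : ι → X → F} (hu : ∀ i, Continuous (u i))
    (hli : ∀ x, LinearIndependent ℝ (u · x)) (i : ι) :
    Continuous fun x => gramSchmidt ℝ (u · x) i := by
  induction i using WellFoundedLT.induction with | ind i ih =>
  set c : ι → X → ℝ := fun j x ↦ ⟪gramSchmidt ℝ (u · x) j, u i x⟫_ℝ / ‖gramSchmidt ℝ (u · x) j‖ ^ 2
    with hc
  have heq : (fun x ↦ gramSchmidt ℝ (u · x) i) = fun x ↦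
      u i x - ∑ j ∈ Finset.Iio i, c j x • gramSchmidt ℝ (u · x) j := by
    funext x
    rw [eq_sub_of_add_eq (gramSchmidt_def'' ℝ (u · x) i).symm]
    simp only [hc, RCLike.ofReal_real_eq_id, id_eq]
  rw [heq]
  refine (hu i).sub (continuous_finsetSum _ fun j hj => ?_)
  have hj' : j < i := Finset.mem_Iio.1 hj
  refine Continuous.smul ?_ (ih j hj')
  refine Continuous.div ((ih j hj').inner (hu i)) (((ih j hj').norm).pow 2) fun x => ?_
  exact pow_ne_zero _ (norm_ne_zero_iff.2 (gramSchmidt_ne_zero j (hli x)))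

/-- The normalised Gram–Schmidt vectors `x ↦ gramSchmidtNormed ℝ (u · x) i` of continuous,
pointwise linearly independent fields are continuous. [folklore] -/
theorem continuous_gramSchmidtNormed_family {u : ι → X → F} (hu : ∀ i, Continuous (u i))
    (hli : ∀ x, LinearIndependent ℝ (u · x)) (i : ι) :
    Continuous fun x => gramSchmidtNormed ℝ (u · x) i := by
  unfold gramSchmidtNormed
  have h := continuous_gramSchmidt_family hu hli i
  refine Continuous.smul ?_ h
  simp only [RCLike.ofReal_real_eq_id, id_eq]
  exact h.norm.inv₀ fun x => norm_ne_zero_iff.2 (gramSchmidt_ne_zero i (hli x))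

end GramSchmidt

section SumElim

variable {F : Type*} [NormedAddCommGroup F] [InnerProductSpace ℝ F]

/-- Two orthonormal families which are mutually orthogonal combine to an orthonormal family
indexed by the sum type. [folklore] -/
theorem orthonormal_sumElim {ι κ : Type*} {v : ι → F} {w : κ → F} (hv : Orthonormal ℝ v)
    (hw : Orthonormal ℝ w) (h : ∀ i j, ⟪v i, w j⟫_ℝ = 0) : Orthonormal ℝ (Sum.elim v w) := by
  classical
  rw [orthonormal_iff_ite] at hv hw ⊢
  rintro (i | i) (j | j)
  · simp [hv i j]
  · simp [h i j]
  · simp [real_inner_comm, h j i]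
  · simp [hw i j]

/-- **Frames near an orthonormal frame are linearly independent**: if `B` is orthonormal and
`∑ᵢ ‖B'ᵢ - Bᵢ‖ < 1` then `B'` is linearly independent (`‖∑ aᵢ Bᵢ‖ = ‖a‖₂` while
`‖∑ aᵢ (B'ᵢ - Bᵢ)‖ ≤ ‖a‖₂ ∑ ‖B'ᵢ - Bᵢ‖`). [folklore] -/
theorem linearIndependent_of_orthonormal_of_sum_norm_sub_lt {ι : Type*} [Fintype ι]
    {B B' : ι → F} (hB : Orthonormal ℝ B) (h : ∑ i, ‖B' i - B i‖ < 1) :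
    LinearIndependent ℝ B' := by
  rw [Fintype.linearIndependent_iff]
  intro a ha
  set A : ℝ := ‖∑ i, a i • B i‖ with hA
  have hA2 : A ^ 2 = ∑ i, a i ^ 2 := by
    rw [hA, ← real_inner_self_eq_norm_sq, hB.inner_sum]
    simp [pow_two]
  have hAnn : 0 ≤ A := norm_nonneg _
  have hai : ∀ i, |a i| ≤ A := fun i => by
    have h1 : a i ^ 2 ≤ A ^ 2 := by
      rw [hA2]
      exact Finset.single_le_sum (fun j _ => sq_nonneg (a j)) (Finset.mem_univ i)
    have h2 := sq_le_sq.1 h1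
    rwa [abs_of_nonneg hAnn] at h2
  have heq : ∑ i, a i • B i = -∑ i, a i • (B' i - B i) := by
    rw [eq_neg_iff_add_eq_zero, ← Finset.sum_add_distrib]
    simpa only [smul_sub, add_sub_cancel] using ha
  have hle : A ≤ A * ∑ i, ‖B' i - B i‖ := by
    calc A = ‖∑ i, a i • (B' i - B i)‖ := by rw [hA, heq, norm_neg]
      _ ≤ ∑ i, ‖a i • (B' i - B i)‖ := norm_sum_le _ _
      _ = ∑ i, |a i| * ‖B' i - B i‖ := by simp [norm_smul]
      _ ≤ ∑ i, A * ‖B' i - B i‖ := Finset.sum_le_sum fun i _ =>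
          mul_le_mul_of_nonneg_right (hai i) (norm_nonneg _)
      _ = A * ∑ i, ‖B' i - B i‖ := by rw [Finset.mul_sum]
  have hA0 : A = 0 := by
    nlinarith [Finset.sum_nonneg (fun i (_ : i ∈ Finset.univ) => norm_nonneg (B' i - B i))]
  have hsum : ∑ i, a i ^ 2 = 0 := by rw [← hA2, hA0]; ring
  intro i
  have := (Finset.sum_eq_zero_iff_of_nonneg (fun j _ => sq_nonneg (a j))).1 hsum i
    (Finset.mem_univ i)
  exact pow_eq_zero_iff two_ne_zero |>.1 this

end SumElim


/-! ### Hausdorff dimension of images of compact manifolds -/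

section DimHManifold

variable {n : ℕ} {M : Type*} [TopologicalSpace M] [ChartedSpace (EuclideanSpace ℝ (Fin n)) M]
  [IsManifold (𝓡 n) ∞ M] [CompactSpace M]
  {F : Type*} [NormedAddCommGroup F] [NormedSpace ℝ F]

/-- **The image of a compact `n`-manifold under a `C¹` map into a normed space has Hausdorff
dimension at most `n`**: cover `M` by finitely many chart balls; on each, the map read in the chart
is `C¹` on a convex set and does not raise Hausdorff dimension (`ContDiffOn.dimH_image_le`).
Hirsch, *Differential Topology*, Ch. 3 §1, Prop. 1.2 (the trivial case of the Morse–Sard theorem: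
`f(M)` has measure zero if `dim M < dim N`). [cite: HirschDT1976, Ch. 3 §1 Prop. 1.2] -/
theorem dimH_range_le_of_contMDiff {g : M → F} (hg : ContMDiff (𝓡 n) 𝓘(ℝ, F) 1 g) :
    dimH (range g) ≤ n := by
  -- chart balls
  have key : ∀ x₀ : M, ∃ A : Set M, A ∈ 𝓝 x₀ ∧ dimH (g '' A) ≤ n := by
    intro x₀
    set φ := chartAt (EuclideanSpace ℝ (Fin n)) x₀ with hφ
    obtain ⟨r, hr, hball⟩ : ∃ r > 0, ball (φ x₀) r ⊆ φ.target :=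
      Metric.isOpen_iff.1 φ.open_target _ (mem_chart_target _ x₀)
    refine ⟨φ.source ∩ φ ⁻¹' ball (φ x₀) r, ?_, ?_⟩
    · exact (φ.isOpen_inter_preimage isOpen_ball).mem_nhds ⟨mem_chart_source _ x₀, mem_ball_self hr⟩
    · have hsymm : ContMDiffOn (𝓡 n) (𝓡 n) 1 φ.symm φ.target := contMDiffOn_chart_symm
      have hG : ContMDiffOn (𝓡 n) 𝓘(ℝ, F) 1 (g ∘ φ.symm) φ.target :=
        hg.comp_contMDiffOn hsymm
      have hG' : ContDiffOn ℝ 1 (g ∘ φ.symm) φ.target := contMDiffOn_iff_contDiffOn.1 hG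
      have hsub : g '' (φ.source ∩ φ ⁻¹' ball (φ x₀) r) ⊆ (g ∘ φ.symm) '' ball (φ x₀) r := by
        rintro _ ⟨x, ⟨hx, hxr⟩, rfl⟩
        exact ⟨φ x, hxr, by simp [φ.left_inv hx]⟩
      calc dimH (g '' (φ.source ∩ φ ⁻¹' ball (φ x₀) r))
          ≤ dimH ((g ∘ φ.symm) '' ball (φ x₀) r) := dimH_mono hsub
        _ ≤ dimH (ball (φ x₀) r) := (hG'.mono hball).dimH_image_le (convex_ball _ _) Subset.rfl
        _ ≤ dimH (univ : Set (EuclideanSpace ℝ (Fin n))) := dimH_mono (subset_univ _)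
        _ = n := by rw [Real.dimH_univ_eq_finrank, finrank_euclideanSpace_fin]
  choose A hA hdim using key
  obtain ⟨t, ht⟩ := CompactSpace.elim_nhds_subcover A hA
  have hcover : range g ⊆ ⋃ x₀ : (t : Set M), g '' A x₀ := by
    rintro _ ⟨x, rfl⟩
    have hx : x ∈ ⋃ x₀ ∈ t, A x₀ := by rw [ht]; trivial
    obtain ⟨x₀, hx₀, hxA⟩ := mem_iUnion₂.1 hx
    exact mem_iUnion.2 ⟨⟨x₀, hx₀⟩, x, hxA, rfl⟩
  calc dimH (range g) ≤ dimH (⋃ x₀ : (t : Set M), g '' A x₀) := dimH_mono hcover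
    _ = ⨆ x₀ : (t : Set M), dimH (g '' A x₀) := dimH_iUnion _
    _ ≤ n := iSup_le fun x₀ => hdim x₀

/-- **A `C¹` map from a compact `n`-manifold into `ℝᵖ⁺¹`, `n < p`, misses a point of the unit
sphere `𝕊ᵖ`** (`dimH f(M) ≤ n < p ≤ dimH (𝕊ᵖ ∖ pt)`, the latter from `SphereMapsMissPoints.lean`).
[cite: HirschDT1976, Ch. 3 §1 Prop. 1.2] -/
theorem exists_norm_eq_one_forall_ne {p : ℕ} (hnp : n < p)
    {g : M → EuclideanSpace ℝ (Fin (p + 1))}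
    (hg : ContMDiff (𝓡 n) 𝓘(ℝ, EuclideanSpace ℝ (Fin (p + 1))) 1 g) :
    ∃ e : EuclideanSpace ℝ (Fin (p + 1)), ‖e‖ = 1 ∧ ∀ x, g x ≠ e := by
  by_contra! h
  let v : sphere (0 : EuclideanSpace ℝ (Fin (p + 1))) 1 := ⟨EuclideanSpace.single 0 1, by simp⟩
  have h1 : sphere (0 : EuclideanSpace ℝ (Fin (p + 1))) 1 \
      {(v : EuclideanSpace ℝ (Fin (p + 1)))} ⊆ range g := by
    rintro y ⟨hy, -⟩
    obtain ⟨x, hx⟩ := h y (by simpa using hy)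
    exact ⟨x, hx⟩
  have h2 :=
    calc (p : ℝ≥0∞)
          ≤ dimH (sphere (0 : EuclideanSpace ℝ (Fin (p + 1))) 1 \
              {(v : EuclideanSpace ℝ (Fin (p + 1)))}) := le_dimH_sphere_diff_singleton v
      _ ≤ dimH (range g) := dimH_mono h1
      _ ≤ n := dimH_range_le_of_contMDiff hg
  exact absurd (by exact_mod_cast h2) (not_le.2 hnp)

end DimHManifold


/-! ### Completing a unit vector field to an orthonormal frame (`p > dim M`) -/

section UnitField

variable {n : ℕ} {M : Type*} [TopologicalSpace M] [ChartedSpace (EuclideanSpace ℝ (Fin n)) M]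
  [IsManifold (𝓡 n) ∞ M] [CompactSpace M] [T2Space M]

/-- **A continuous unit field `c : M → 𝕊ᵖ ⊂ ℝᵖ⁺¹`, `p > dim M`, extends to a continuous orthonormal
frame `(c, d₁, …, d_p)` of `ℝᵖ⁺¹`** (the concrete content of Kervaire–Milnor's Lemma 3.5 for
`r = 1`: the line bundle `ℝ c` has the complement `c^⊥ = c^* T𝕊ᵖ`, trivial because `c` is, after a
smooth approximation, not surjective onto `𝕊ᵖ`; Kervaire–Milnor's bundle map to `γᵖ` over `Sᵖ`,
"null-homotopic since `k > n`"). Steps: smooth approximation `c̃ = g/‖g‖` of `c` with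
`‖c̃ - c‖ < 1/2` (`Continuous.exists_contMDiff_approx`); a point `e ∈ 𝕊ᵖ` off `c̃(M)`
(`exists_norm_eq_one_forall_ne`); an orthonormal basis `(-e, b₁, …, b_p)` reflected in the line
`ℝ(c̃ x - e)` (`-e ↦ c̃ x`) and then in `ℝ(c̃ x + c x)` (`c̃ x ↦ c x`).
[cite: KervaireMilnorAnnals1963, §3, Lemma 3.5 (p. 509), case r = 1] -/
theorem exists_orthonormal_cons {p : ℕ} (hnp : n < p) {c : M → EuclideanSpace ℝ (Fin (p + 1))}
    (hc : Continuous c) (hc1 : ∀ x, ‖c x‖ = 1) :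
    ∃ d : Fin p → M → EuclideanSpace ℝ (Fin (p + 1)), (∀ i, Continuous (d i)) ∧
      ∀ x, Orthonormal ℝ
        (Fin.cons (c x) (fun i => d i x) : Fin (p + 1) → EuclideanSpace ℝ (Fin (p + 1))) := by
  -- B1: a smooth approximation `g` of `c`, renormalised to a smooth unit field `c'`
  obtain ⟨g, hg, hg'⟩ : ∃ g : M → EuclideanSpace ℝ (Fin (p + 1)),
      ContMDiff (𝓡 n) 𝓘(ℝ, EuclideanSpace ℝ (Fin (p + 1))) ∞ g ∧ ∀ x, ‖g x - c x‖ < 1 / 4 := by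
    obtain ⟨g, hg, -⟩ := hc.exists_contMDiff_approx (𝓡 n) ⊤ continuous_const
      (fun _ => (by norm_num : (0 : ℝ) < 1 / 4))
    exact ⟨g, g.contMDiff, fun x => by simpa [dist_eq_norm] using hg x⟩
  have hg0 : ∀ x, g x ≠ 0 := fun x h0 => by
    have := hg' x
    rw [h0, zero_sub, norm_neg, hc1 x] at this
    norm_num at this
  set c' : M → EuclideanSpace ℝ (Fin (p + 1)) := fun x => ‖g x‖⁻¹ • g x with hc'def
  have hc' : ContMDiff (𝓡 n) 𝓘(ℝ, EuclideanSpace ℝ (Fin (p + 1))) ∞ c' := fun x =>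
    ContDiffAt.comp_contMDiffAt (I := 𝓡 n)
      (g := fun y : EuclideanSpace ℝ (Fin (p + 1)) => ‖y‖⁻¹ • y) (f := g) (x := x)
      (((contDiffAt_norm ℝ (hg0 x)).inv (norm_ne_zero_iff.2 (hg0 x))).smul contDiffAt_id) (hg x)
  have hc'1 : ∀ x, ‖c' x‖ = 1 := fun x => by
    simp only [hc'def, norm_smul, norm_inv, norm_norm]
    exact inv_mul_cancel₀ (norm_ne_zero_iff.2 (hg0 x))
  have hc'c : ∀ x, ‖c' x - c x‖ < 1 / 2 := fun x => by
    have h1 : c' x - c x = (‖g x‖⁻¹ - 1) • g x + (g x - c x) := by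
      simp only [hc'def, sub_smul, one_smul]; abel
    have h2 : ‖(‖g x‖⁻¹ - 1) • g x‖ = |1 - ‖g x‖| := by
      rw [norm_smul, Real.norm_eq_abs, ← abs_of_nonneg (norm_nonneg (g x)), ← abs_mul,
        abs_of_nonneg (norm_nonneg (g x)), sub_mul,
        inv_mul_cancel₀ (norm_ne_zero_iff.2 (hg0 x)), one_mul]
    have h3 : |1 - ‖g x‖| < 1 / 4 := by
      have := abs_norm_sub_norm_le (c x) (g x)
      rw [hc1 x] at this
      calc |1 - ‖g x‖| ≤ ‖c x - g x‖ := this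
        _ = ‖g x - c x‖ := norm_sub_rev _ _
        _ < 1 / 4 := hg' x
    calc ‖c' x - c x‖ = ‖(‖g x‖⁻¹ - 1) • g x + (g x - c x)‖ := by rw [h1]
      _ ≤ ‖(‖g x‖⁻¹ - 1) • g x‖ + ‖g x - c x‖ := norm_add_le _ _
      _ < 1 / 4 + 1 / 4 := by rw [h2]; exact add_lt_add h3 (hg' x)
      _ = 1 / 2 := by norm_num
  -- B2: `c'` misses a point `e` of the sphere
  obtain ⟨e, he1, hne⟩ := exists_norm_eq_one_forall_ne hnp (hc'.of_le (by exact_mod_cast le_top))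
  -- B3: an orthonormal basis `b` with `b 0 = -e`, reflected so that `-e ↦ c' x`
  obtain ⟨b, hb⟩ := Orthonormal.exists_orthonormalBasis_extension_of_card_eq (𝕜 := ℝ)
    (E := EuclideanSpace ℝ (Fin (p + 1))) (ι := Fin (p + 1)) (by simp) (v := fun _ => -e)
    (s := {0})
    ⟨fun i => by simp [he1], _root_.Subsingleton.pairwise⟩
  have hb0 : b 0 = -e := hb 0 rfl
  have hsub : ∀ x, c' x - e ≠ 0 := fun x => sub_ne_zero.2 (hne x)
  set d' : Fin p → M → EuclideanSpace ℝ (Fin (p + 1)) :=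
    fun i x => (ℝ ∙ (c' x - e)).reflection (b i.succ) with hd'def
  have hd'eq : ∀ x,
      (Fin.cons (c' x) (fun i => d' i x) : Fin (p + 1) → EuclideanSpace ℝ (Fin (p + 1))) =
        fun i => (ℝ ∙ (c' x - e)).reflection (b i) := by
    intro x
    funext i
    refine Fin.cases ?_ (fun j => ?_) i
    · rw [Fin.cons_zero, hb0, ← neg_add_eq_sub]
      exact (reflection_span_add_apply_left (by rw [norm_neg, he1]) (hc'1 x)).symm
    · rw [Fin.cons_succ]
  have hd'o : ∀ x, Orthonormal ℝ
      (Fin.cons (c' x) (fun i => d' i x) : Fin (p + 1) → EuclideanSpace ℝ (Fin (p + 1))) :=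
    fun x => by rw [hd'eq]; exact b.orthonormal.comp_linearIsometryEquiv _
  have hd'c : ∀ i, Continuous (d' i) := fun i =>
    continuous_reflection_span_singleton (hc'.continuous.sub continuous_const) continuous_const hsub
  -- B4: reflect once more, `c' x ↦ c x`
  have hadd : ∀ x, c' x + c x ≠ 0 := fun x h0 => by
    have h1 : c x = -c' x := eq_neg_of_add_eq_zero_right h0
    have := hc'c x
    rw [h1, sub_neg_eq_add, ← two_smul ℝ, norm_smul, hc'1 x, Real.norm_eq_abs] at this
    norm_num at this
  refine ⟨fun i x => (ℝ ∙ (c' x + c x)).reflection (d' i x), fun i =>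
    continuous_reflection_span_singleton (hc'.continuous.add hc) (hd'c i) hadd, fun x => ?_⟩
  have heq : (Fin.cons (c x) (fun i => (ℝ ∙ (c' x + c x)).reflection (d' i x)) :
      Fin (p + 1) → EuclideanSpace ℝ (Fin (p + 1))) =
      fun i => (ℝ ∙ (c' x + c x)).reflection ((Fin.cons (c' x) (fun i => d' i x) :
        Fin (p + 1) → EuclideanSpace ℝ (Fin (p + 1))) i) := by
    funext i
    refine Fin.cases ?_ (fun j => ?_) i
    · rw [Fin.cons_zero, Fin.cons_zero]
      exact (reflection_span_add_apply_left (hc'1 x) (hc1 x)).symm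
    · rw [Fin.cons_succ, Fin.cons_succ]
  rw [heq]
  exact (hd'o x).comp_linearIsometryEquiv _

end UnitField

/-! ### Extending an orthonormal `m`-frame field by `p > dim M` fields -/

section Extension

variable {n : ℕ} {M : Type*} [TopologicalSpace M] [ChartedSpace (EuclideanSpace ℝ (Fin n)) M]
  [IsManifold (𝓡 n) ∞ M] [CompactSpace M] [T2Space M]

/-- **Kervaire–Milnor's Lemma 3.5 in frame form.** Let `M` be a compact `n`-manifold and
`u₁, …, u_m : M → F` continuous, pointwise orthonormal fields in an inner product space of
dimension `m + p` with `p > n`. Then there are continuous fields `w₁, …, w_p` completing them to an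
orthonormal frame of `F` at every point; i.e. the complement `(u₁, …, u_m)^⊥`, a stably trivial
bundle of rank `p > dim M`, is trivial. Induction on `m`, the step being
`exists_orthonormal_cons` applied to the unit coefficient vector `c x ∈ 𝕊ᵖ ⊂ ℝᵖ⁺¹` of `u_{m+1}`
in a completing frame `(w₁, …, w_{p+1})` of `(u₁, …, u_m)` and the isometric recombination
`a ↦ ∑ aⱼ wⱼ`. Kervaire–Milnor (1963), p. 509, Lemma 3.5: "If the Whitney sum of `ξ` with a
trivial bundle `εʳ` is trivial then `ξ` itself is trivial" (`ξ` a `k`-plane bundle over an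
`n`-complex, `k > n`), here for subbundles of a trivial bundle over a compact manifold.
[cite: KervaireMilnorAnnals1963, §3, Lemma 3.5 (p. 509)] -/
theorem exists_orthonormal_sumElim :
    ∀ (m p : ℕ) {F : Type*} [NormedAddCommGroup F] [InnerProductSpace ℝ F]
      [FiniteDimensional ℝ F], finrank ℝ F = m + p → n < p →
      ∀ u : Fin m → M → F, (∀ i, Continuous (u i)) → (∀ x, Orthonormal ℝ fun i => u i x) →
      ∃ w : Fin p → M → F, (∀ j, Continuous (w j)) ∧
        ∀ x, Orthonormal ℝ (Sum.elim (fun i => u i x) (fun j => w j x)) := by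
  intro m
  induction m with
  | zero =>
    intro p F _ _ _ hF hnp u hu huo
    have hF' : finrank ℝ F = p := by simpa using hF
    let B : OrthonormalBasis (Fin p) ℝ F := (stdOrthonormalBasis ℝ F).reindex (finCongr hF')
    exact ⟨fun j _ => B j, fun j => continuous_const, fun x =>
      orthonormal_sumElim (huo x) B.orthonormal fun i => Fin.elim0 i⟩
  | succ m ih =>
    intro p F _ _ _ hF hnp u hu huo
    -- the first `m` fields and a completing frame `w` of `p + 1` fields
    set u' : Fin m → M → F := fun i => u (Fin.castSucc i) with hu'def
    have hu'o : ∀ x, Orthonormal ℝ fun i => u' i x := fun x =>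
      (huo x).comp _ (Fin.castSucc_injective m)
    obtain ⟨w, hw, hwo⟩ := ih (p + 1) (F := F) (by rw [hF]; ring) (Nat.lt_succ_of_lt hnp) u'
      (fun i => hu _) hu'o
    have hwo' : ∀ x, Orthonormal ℝ fun j => w j x := fun x => (hwo x).comp _ Sum.inr_injective
    have hcross : ∀ x i j, ⟪u' i x, w j x⟫_ℝ = 0 := fun x i j =>
      (hwo x).inner_eq_zero (Sum.inl_ne_inr : Sum.inl i ≠ Sum.inr j)
    -- the last field `v` and its coefficients `c x ∈ ℝᵖ⁺¹` in the frame `w`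
    set v : M → F := u (Fin.last m) with hvdef
    have hv1 : ∀ x, ‖v x‖ = 1 := fun x => (huo x).norm_eq_one (Fin.last m)
    have hvu' : ∀ x i, ⟪u' i x, v x⟫_ℝ = 0 := fun x i =>
      (huo x).inner_eq_zero (Fin.castSucc_ne_last i)
    set c : M → EuclideanSpace ℝ (Fin (p + 1)) := fun x =>
      (EuclideanSpace.equiv (Fin (p + 1)) ℝ).symm fun j => ⟪w j x, v x⟫_ℝ with hcdef
    have hc_apply : ∀ x j, c x j = ⟪w j x, v x⟫_ℝ := fun x j => rfl
    have hcc : Continuous c :=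
      (EuclideanSpace.equiv (Fin (p + 1)) ℝ).symm.continuous.comp
        (continuous_pi fun j => (hw j).inner (hu _))
    -- the recombination `a ↦ ∑ aⱼ wⱼ` is isometric
    have hΦ : ∀ x (a a' : EuclideanSpace ℝ (Fin (p + 1))),
        ⟪∑ j, a j • w j x, ∑ j, a' j • w j x⟫_ℝ = ⟪a, a'⟫_ℝ := by
      intro x a a'
      rw [(hwo' x).inner_sum, PiLp.inner_apply]
      simp [mul_comm]
    -- expansion of `v` in the orthonormal basis `(u', w)`
    have hv_exp : ∀ x, ∑ j, c x j • w j x = v x := by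
      intro x
      have hcard : Fintype.card (Fin m ⊕ Fin (p + 1)) = finrank ℝ F := by
        simp only [Fintype.card_sum, Fintype.card_fin, hF]; ring
      let bx : OrthonormalBasis (Fin m ⊕ Fin (p + 1)) ℝ F := OrthonormalBasis.mk (hwo x)
        ((hwo x).linearIndependent.span_eq_top_of_card_eq_finrank' hcard).ge
      have hbx : ⇑bx = Sum.elim (fun i => u' i x) (fun j => w j x) := OrthonormalBasis.coe_mk _ _
      have := bx.sum_repr' (v x)
      rw [Fintype.sum_sum_type, hbx] at this
      simpa [hvu', hc_apply] using this
    have hc1 : ∀ x, ‖c x‖ = 1 := fun x => by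
      have h := hΦ x (c x) (c x)
      rw [hv_exp x, real_inner_self_eq_norm_sq, real_inner_self_eq_norm_sq, hv1 x] at h
      have : ‖c x‖ ^ 2 = 1 := by rw [← h]; ring
      simpa using (pow_eq_one_iff_of_nonneg (norm_nonneg (c x)) two_ne_zero).1 this
    -- complete `c` and recombine
    obtain ⟨d, hd, hdo⟩ := exists_orthonormal_cons hnp hcc hc1
    refine ⟨fun i x => ∑ j, d i x j • w j x, fun i => ?_, fun x => ?_⟩
    · exact continuous_finsetSum _ fun j _ =>
        (((EuclideanSpace.proj j).continuous).comp (hd i)).smul (hw j)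
    · refine orthonormal_sumElim (huo x) ?_ ?_
      · have hdo' : Orthonormal ℝ fun i => d i x := by
          have := (hdo x).comp _ (Fin.succ_injective p)
          simpa [Function.comp_def, Fin.cons_succ] using this
        classical
        rw [orthonormal_iff_ite] at hdo' ⊢
        intro i j
        rw [hΦ, hdo' i j]
      · intro i j
        rcases Fin.eq_castSucc_or_eq_last i with ⟨i, rfl⟩ | rfl
        · rw [inner_sum]
          refine Finset.sum_eq_zero fun j' _ => ?_
          rw [real_inner_smul_right, hcross x i j', mul_zero]
        · change ⟪v x, ∑ j', d j x j' • w j' x⟫_ℝ = 0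
          rw [← hv_exp x, hΦ]
          have := (hdo x).inner_eq_zero (Fin.succ_ne_zero j).symm
          simpa [Fin.cons_zero, Fin.cons_succ] using this

end Extension

/-! ### Kervaire–Milnor's Lemma 3.3 -/

section Lemma33

variable {n : ℕ} {M : Type*} [TopologicalSpace M] [ChartedSpace (EuclideanSpace ℝ (Fin n)) M]
  [IsManifold (𝓡 n) ∞ M] {E : Type*} [NormedAddCommGroup E] [InnerProductSpace ℝ E]

/-- **The ambient differential is continuous on continuous vector fields**: if `f : M → 𝕊ᵐ ⊆ E`
is `C^∞` and `σ` is a continuous section of `TM` (continuity into Mathlib's `TangentBundle`), then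
`x ↦ d(ι ∘ f)ₓ (σ x) ∈ E` is continuous — continuity of the tangent map `T(ι ∘ f)`
(`ContMDiff.continuous_tangentMap`) and triviality of `TE` (`tangentBundleModelSpaceHomeomorph`).
[folklore] -/
theorem continuous_ambientDeriv_apply {m : ℕ} [Fact (finrank ℝ E = m + 1)]
    {f : M → sphere (0 : E) 1} (hf : ContMDiff (𝓡 n) (𝓡 m) ∞ f) {σ : M → EuclideanSpace ℝ (Fin n)}
    (hσ : Continuous fun x =>
      (TotalSpace.mk' (EuclideanSpace ℝ (Fin n)) x (σ x) : TangentBundle (𝓡 n) M)) :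
    Continuous fun x => ambientDeriv (𝓡 n) f x (σ x) := by
  have hg : ContMDiff (𝓡 n) 𝓘(ℝ, E) ∞ fun y => (f y : E) := contMDiff_coe_sphere.comp hf
  have h1 : Continuous (tangentMap (𝓡 n) 𝓘(ℝ, E) fun y => (f y : E)) :=
    hg.continuous_tangentMap (by exact_mod_cast le_top)
  have h2 : Continuous fun q : TangentBundle 𝓘(ℝ, E) E => q.2 :=
    continuous_snd.comp (tangentBundleModelSpaceHomeomorph 𝓘(ℝ, E)).continuous
  exact h2.comp (h1.comp hσ)

/-- **Kervaire–Milnor's Lemma 3.3, direction `⇒`, for immersions into the unit sphere of an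
inner product space.** Let `M` be a compact `C^∞` `n`-manifold which is s-parallelizable
(`IsStablyParallelizable`: a continuous framing of `TM ⊕ ℝ`) and `f : M → 𝕊ⁿ⁺ᵏ ⊆ E`
(`dim E = n + k + 1`), `n < k`, a `C^∞` immersion. Then `f` has a normal framing by `k` smooth
fields (`IsNormalFraming`). Kervaire–Milnor, *Groups of homotopy spheres I* (1963), p. 509:
"LEMMA 3.3. Let `M` be an `n`-dimensional submanifold of `Sⁿ⁺ᵏ`, `n < k`. Then `M` is
s-parallelizable if and only if its normal bundle is trivial", proved there from "LEMMA 3.5. If the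
Whitney sum of `ξ` with a trivial bundle `εʳ` is trivial then `ξ` itself is trivial" (`ξ` a
`k`-plane bundle over an `n`-complex, `k > n`) by "`τ ⊕ ν` is trivial hence `(τ ⊕ ε¹) ⊕ ν` is
trivial. Applying Lemma 3.5 the conclusion follows."

*Proof formalised.* The continuous framing `(vⱼ, tⱼ)` of `TM ⊕ ℝ` is carried by the injective
linear maps `Lₓ (v, t) = d(ι∘f)ₓ v + t f(x)` to `n + 1` continuous, pointwise independent fields
`Uⱼ` spanning `df(TₓM) ⊕ ℝ f(x) ⊆ E` (so the normal bundle is its orthogonal complement: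
`(τ ⊕ ε¹) ⊕ ν = εⁿ⁺ᵏ⁺¹`); Gram–Schmidt makes them orthonormal
(`continuous_gramSchmidtNormed_family`); Lemma 3.5 in the concrete form
`exists_orthonormal_sumElim` completes them by `k` continuous fields `wᵢ`; these are smoothed
(`Continuous.exists_contMDiff_approx`; independence is open,
`linearIndependent_of_orthonormal_of_sum_norm_sub_lt`) and projected to `T_{f x} 𝕊ⁿ⁺ᵏ`.
[cite: KervaireMilnorAnnals1963, §3, Lemma 3.3 (p. 509), with Lemma 3.5] -/
theorem exists_isNormalFraming_of_isStablyParallelizable_of_lt [T2Space M] [CompactSpace M]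
    {k : ℕ} [Fact (finrank ℝ E = n + k + 1)] (hM : IsStablyParallelizable (𝓡 n) M) (hnk : n < k)
    {f : M → sphere (0 : E) 1} (hf : ContMDiff (𝓡 n) (𝓡 (n + k)) ∞ f)
    (hf' : ∀ x, Injective (mfderiv (𝓡 n) (𝓡 (n + k)) f x)) :
    ∃ fr : Fin k → M → E, IsNormalFraming (𝓡 n) f fr := by
  haveI : FiniteDimensional ℝ E := .of_fact_finrank_eq_succ (n + k)
  obtain ⟨s, hs, hs2, hsli⟩ := hM
  -- the differential of `ι ∘ f`: injective, tangent to the sphere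
  have hfE : ContMDiff (𝓡 n) 𝓘(ℝ, E) ∞ fun y => (f y : E) := contMDiff_coe_sphere.comp hf
  have hcomp : ∀ x, ambientDeriv (𝓡 n) f x =
      (mfderiv (𝓡 (n + k)) 𝓘(ℝ, E) (Subtype.val : sphere (0 : E) 1 → E) (f x)).comp
        (mfderiv (𝓡 n) (𝓡 (n + k)) f x) := fun x =>
    mfderiv_comp x ((contMDiff_coe_sphere (m := 1)).contMDiffAt.mdifferentiableAt one_ne_zero)
      ((hf x).mdifferentiableAt (by simp))
  have hDinj : ∀ x, Injective (ambientDeriv (𝓡 n) f x) := fun x => by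
    have heq : (ambientDeriv (𝓡 n) f x : EuclideanSpace ℝ (Fin n) → E) =
        (mfderiv (𝓡 (n + k)) 𝓘(ℝ, E) (Subtype.val : sphere (0 : E) 1 → E) (f x)) ∘
          (mfderiv (𝓡 n) (𝓡 (n + k)) f x) := by
      funext w
      rw [hcomp]
      rfl
    rw [heq]
    exact (mfderiv_coe_sphere_injective (n := n + k) (f x)).comp (hf' x)
  have hDtan : ∀ x v, ⟪ambientDeriv (𝓡 n) f x v, (f x : E)⟫_ℝ = 0 := fun x v => by
    have hmem : ambientDeriv (𝓡 n) f x v ∈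
        (mfderiv (𝓡 (n + k)) 𝓘(ℝ, E) (Subtype.val : sphere (0 : E) 1 → E) (f x)).range :=
      ⟨mfderiv (𝓡 n) (𝓡 (n + k)) f x v, by rw [hcomp]; rfl⟩
    rw [range_mfderiv_coe_sphere (f x)] at hmem
    exact Submodule.mem_orthogonal_singleton_iff_inner_left.1 hmem
  have hf1 : ∀ x, ‖(f x : E)‖ = 1 := fun x => norm_eq_of_mem_sphere (f x)
  -- (1) the fields `Uⱼ = df(vⱼ) + tⱼ f`, images of the stable framing under `L x`
  set L : ∀ x : M, (EuclideanSpace ℝ (Fin n) × ℝ) →ₗ[ℝ] E := fun x =>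
    (ambientDeriv (𝓡 n) f x).toLinearMap.coprod (LinearMap.toSpanSingleton ℝ E (f x : E))
    with hLdef
  have hL : ∀ x z, L x z = ambientDeriv (𝓡 n) f x z.1 + z.2 • (f x : E) := fun x z => by
    simp [hLdef]
  have hLker : ∀ x, LinearMap.ker (L x) = ⊥ := fun x => by
    rw [LinearMap.ker_eq_bot']
    rintro ⟨v, t⟩ hz
    rw [hL] at hz
    have ht : t = 0 := by
      have := congrArg (fun w => ⟪w, (f x : E)⟫_ℝ) hz
      simpa [inner_add_left, real_inner_smul_left, hDtan, real_inner_self_eq_norm_sq, hf1]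
        using this
    simp only [ht, zero_smul, add_zero] at hz
    have hv : v = 0 := hDinj x (by rw [map_zero]; exact hz)
    simp [ht, hv]
  set U : Fin (finrank ℝ (EuclideanSpace ℝ (Fin n)) + 1) → M → E := fun j x => L x (s j x)
    with hUdef
  have hUc : ∀ j, Continuous (U j) := fun j => by
    simp only [hUdef, hL]
    exact (continuous_ambientDeriv_apply hf (hs j)).add
      ((hs2 j).smul (continuous_subtype_val.comp hf.continuous))
  have hUli : ∀ x, LinearIndependent ℝ (U · x) := fun x => (hsli x).map' (L x) (hLker x)
  have hUspan : ∀ x (z : EuclideanSpace ℝ (Fin n) × ℝ),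
      L x z ∈ Submodule.span ℝ (Set.range (U · x)) := by
    intro x z
    have hcard : Fintype.card (Fin (finrank ℝ (EuclideanSpace ℝ (Fin n)) + 1)) =
        finrank ℝ (EuclideanSpace ℝ (Fin n) × ℝ) := by simp
    have htop := (hsli x).span_eq_top_of_card_eq_finrank' hcard
    have hz : z ∈ Submodule.span ℝ (Set.range (s · x)) := by rw [htop]; trivial
    have hrange : Set.range (U · x) = L x '' Set.range (s · x) := by
      rw [← Set.range_comp]; rfl
    rw [hrange, Submodule.span_image]
    exact Submodule.mem_map_of_mem hz
  -- (2) Gram–Schmidt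
  set U' : Fin (finrank ℝ (EuclideanSpace ℝ (Fin n)) + 1) → M → E :=
    fun j x => gramSchmidtNormed ℝ (U · x) j with hU'def
  have hU'c : ∀ j, Continuous (U' j) := fun j => continuous_gramSchmidtNormed_family hUc hUli j
  have hU'o : ∀ x, Orthonormal ℝ (U' · x) := fun x => gramSchmidtNormed_orthonormal (hUli x)
  have hU'span : ∀ x, Submodule.span ℝ (Set.range (U' · x)) =
      Submodule.span ℝ (Set.range (U · x)) := fun x => by
    simp only [hU'def]
    rw [span_gramSchmidtNormed_range, span_gramSchmidt]
  -- (3) Lemma 3.5: complete by `k > n` continuous fields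
  have hF : finrank ℝ E = (finrank ℝ (EuclideanSpace ℝ (Fin n)) + 1) + k := by
    rw [Fact.out (p := finrank ℝ E = n + k + 1), finrank_euclideanSpace_fin]; omega
  obtain ⟨w, hw, hwo⟩ :=
    exists_orthonormal_sumElim (M := M) (finrank ℝ (EuclideanSpace ℝ (Fin n)) + 1) k hF hnk U'
      hU'c hU'o
  -- (4) smoothing
  have hε : (0 : ℝ) < 1 / (k + 1) := by positivity
  have key : ∀ j, ∃ g : M → E, ContMDiff (𝓡 n) 𝓘(ℝ, E) ∞ g ∧
      ∀ x, ‖g x - w j x‖ < 1 / (k + 1) := fun j => by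
    obtain ⟨g, hg, -⟩ := (hw j).exists_contMDiff_approx (𝓡 n) ⊤ continuous_const fun _ => hε
    exact ⟨g, g.contMDiff, fun x => by simpa [dist_eq_norm] using hg x⟩
  choose g hg hgw using key
  have hLI : ∀ x, LinearIndependent ℝ (Sum.elim (U' · x) (fun j => g j x)) := fun x => by
    refine linearIndependent_of_orthonormal_of_sum_norm_sub_lt (hwo x) ?_
    rw [Fintype.sum_sum_type]
    simp only [Sum.elim_inl, Sum.elim_inr, sub_self, norm_zero, Finset.sum_const_zero, zero_add]
    calc ∑ j, ‖g j x - w j x‖ ≤ ∑ _j : Fin k, (1 / (k + 1) : ℝ) :=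
          Finset.sum_le_sum fun j _ => (hgw j x).le
      _ = (k : ℝ) / (k + 1) := by
          rw [Finset.sum_const, Finset.card_univ, Fintype.card_fin, nsmul_eq_mul, mul_one_div]
      _ < 1 := (div_lt_one (by positivity)).2 (by linarith)
  -- (5) the normal framing: tangential projections of the smoothed fields
  have hP : ContDiff ℝ ∞ fun q : E × E => q.1 - ⟪q.1, q.2⟫_ℝ • q.2 :=
    contDiff_fst.sub ((contDiff_fst.inner ℝ contDiff_snd).smul contDiff_snd)
  refine ⟨fun j x => g j x - ⟪g j x, (f x : E)⟫_ℝ • (f x : E),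
    ⟨fun j => hP.comp_contMDiff ((hg j).prodMk_space hfE), fun j x => ?_, fun x v a hva => ?_⟩⟩
  · rw [inner_sub_left, real_inner_smul_left, real_inner_self_eq_norm_sq, hf1, one_pow, mul_one,
      sub_self]
  · -- `df v - (∑ aᵢ ⟪gᵢ, f⟫) f + ∑ aᵢ gᵢ = 0` with the first two terms in `span U'`
    set y : E := ambientDeriv (𝓡 n) f x v - (∑ i, a i * ⟪g i x, (f x : E)⟫_ℝ) • (f x : E)
      with hydef
    have hy : y + ∑ i, a i • g i x = 0 := by
      rw [← hva, hydef]
      simp only [smul_sub, Finset.sum_sub_distrib, Finset.sum_smul, smul_smul]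
      abel
    have hymem : y ∈ Submodule.span ℝ (Set.range (U' · x)) := by
      rw [hU'span]
      have := hUspan x (v, -(∑ i, a i * ⟪g i x, (f x : E)⟫_ℝ))
      rwa [hL, neg_smul, ← sub_eq_add_neg] at this
    obtain ⟨b, hb⟩ := (Submodule.mem_span_range_iff_exists_fun ℝ).1 hymem
    have h0 := Fintype.linearIndependent_iff.1 (hLI x) (Sum.elim b a) (by
      rw [Fintype.sum_sum_type]
      simp only [Sum.elim_inl, Sum.elim_inr]
      rw [hb, hy])
    funext j
    exact h0 (Sum.inr j)

/-- **Kervaire–Milnor's Lemma 3.3, direction `⇒` — discharge of the named fact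
`Literature.Topology.FourManifolds.exists_isNormalFraming_of_isStablyParallelizable`**
(`WhitneySphereEmbedding.lean`): the normal bundle of an s-parallelizable compact `n`-manifold
immersed in `𝕊ⁿ⁺ᵏ ⊂ ℝⁿ⁺ᵏ⁺¹`, `n < k`, has a framing by `k` smooth fields
(`exists_isNormalFraming_of_isStablyParallelizable_of_lt` for `E = ℝⁿ⁺ᵏ⁺¹`; the hypothesis
`Injective f` of the named fact is not needed). Kervaire–Milnor, *Groups of homotopy spheres I*,
Ann. of Math. 77 (1963), §3, Lemma 3.3, p. 509, proved from Lemma 3.5 (ibid.).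
[cite: KervaireMilnorAnnals1963, §3, Lemma 3.3 (p. 509), with Lemma 3.5] -/
theorem exists_isNormalFraming_of_isStablyParallelizable_holds :
    exists_isNormalFraming_of_isStablyParallelizable := by
  intro n k M _ _ _ _ _ _ hM hnk f hf _ hf'
  have : Fact (finrank ℝ (EuclideanSpace ℝ (Fin (n + k + 1))) = n + k + 1) :=
    ⟨finrank_euclideanSpace_fin⟩
  exact exists_isNormalFraming_of_isStablyParallelizable_of_lt hM hnk hf hf'

end Lemma33

end Literature.Topology.FourManifolds
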